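import Mathlib
import Literature.NumberTheory.Transcendental.ZagierDilogarithmConjecture
import Literature.NumberTheory.Transcendental.BlochWignerDilogarithm
import Summits.KontsevichZagierPeriods.KontsevichZagierPeriods.Theorems.HyperbolicBlochZagierDilogarithmConjectureGaussSectorHeadline
import Summits.KontsevichZagierPeriods.KontsevichZagierPeriods.Theorems.HyperbolicBlochZagierDilogarithmConjectureGaussSectorAnharmonic
import Summits.KontsevichZagierPeriods.KontsevichZagierPeriods.Theorems.HyperbolicBlochZagierDilogarithmConjectureStubKummerDescent
import Summits.KontsevichZagierPeriods.KontsevichZagierPeriods.Theorems.ZagierDilogarithmConjecture.Negative.DehnInvariant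
import HarnessLib

/-!
# `ZagierDilogarithmConjecture` (stmt-KontsevichZagierPeriods-10550) — line `kummer-clausen-linearisation`
# (c5 cycle 4): the Gaussian exceptional-unit sector on the anharmonic–conjugation ORBITS (canonical form)

The 147 exceptional units of `ℤ[i,1/10]` are exactly the images of 17 representatives — the 15 class representatives
`r₀,…,r₁₄` of `stub_gaussUnitSector` and the two real ones `−1`, `−4` — under the twelve maps
`w ↦ w, w⁻¹, 1−w, (1−w)⁻¹, 1−w⁻¹, w/(w−1)` and the same composed with complex conjugation. On every finite family valued in
this set, Zagier's conjecture (Dehn-zero part) holds EXACTLY and UNCONDITIONALLY: `stub_gaussExceptionalUnitOrbits`. The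
point-to-representative folds are generic consequences of the anharmonic relators (`anh_*`, file `…GaussSectorAnharmonic`) and of
the conjugation / real relators; then fibrewise regrouping over `Fin 15` and the row theorem `stub_gaussUnitSector`. (The three
landed fold files `gsec_fold_*` list the same 147 points explicitly.) Lead c5 cycle 4. Sorry-free; axioms ⊆ {propext, Classical.choice,
Quot.sound}.
-/

noncomputable section

open scoped BigOperators ComplexConjugate
open Literature.NumberTheory.Transcendental
open Summit.KontsevichZagierPeriods.HyperbolicBloch
open Summit.KontsevichZagierPeriods.HyperbolicBloch.ZagierDilogarithmConjectureNegative (dehn dehn_eq_zero_of_mem_closure)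

namespace Summit.KontsevichZagierPeriods.HyperbolicBloch.ZagierDilogarithmCertificate

/-- The six anharmonic images of an algebraic `x ∉ {0,1}` fold onto `±[x]` modulo `⟨dilogRelators⟩`. [cite: Neumann1998, §2 eq. (2.3)] -/
theorem anh_fold_six {x z : ℂ} (hx : IsAlgebraic ℚ x) (h0 : x ≠ 0) (h1 : x ≠ 1)
    (hz : z = x ∨ z = x⁻¹ ∨ z = 1 - x ∨ z = (1 - x)⁻¹ ∨ z = 1 - x⁻¹ ∨ z = x / (x - 1)) :
    ∃ S : ℤ, FreeAbelianGroup.of z - S • FreeAbelianGroup.of x ∈ AddSubgroup.closure dilogRelators := by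
  have h1' : (1 - x) ≠ 0 := sub_ne_zero.2 (Ne.symm h1)
  have h1'' : (x - 1) ≠ 0 := sub_ne_zero.2 h1
  rcases hz with rfl | rfl | rfl | rfl | rfl | rfl
  · exact ⟨1, by simp⟩
  · refine ⟨-1, ?_⟩
    have h := anh_inv hx h0 h1 (mul_inv_cancel₀ h0)
    convert h using 1
    abel
  · refine ⟨-1, ?_⟩
    have h := anh_one_sub (y := 1 - x) hx h0 h1 (by ring)
    convert h using 1
    abel
  · refine ⟨1, ?_⟩
    have h := anh_inv_one_sub (y := (1 - x)⁻¹) hx h0 h1 (inv_mul_cancel₀ h1')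
    convert neg_mem h using 1
    abel
  · refine ⟨1, ?_⟩
    have h := anh_one_sub_inv (y := 1 - x⁻¹) hx h0 h1 (by rw [sub_sub_cancel, inv_mul_cancel₀ h0])
    convert neg_mem h using 1
    abel
  · refine ⟨-1, ?_⟩
    have h := anh_div_sub_one (y := x / (x - 1)) hx h0 h1 (div_mul_cancel₀ x h1'')
    convert h using 1
    abel

/-- The twelve anharmonic–conjugation images of an algebraic `x ∉ {0,1}` fold onto `±[x]` modulo `⟨dilogRelators⟩`.
[cite: Neumann1998, §2 eq. (2.3)] -/
theorem anh_fold_twelve {x z : ℂ} (hx : IsAlgebraic ℚ x) (h0 : x ≠ 0) (h1 : x ≠ 1)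
    (hz : z = x ∨ z = x⁻¹ ∨ z = 1 - x ∨ z = (1 - x)⁻¹ ∨ z = 1 - x⁻¹ ∨ z = x / (x - 1) ∨
      z = conj x ∨ z = (conj x)⁻¹ ∨ z = 1 - conj x ∨ z = (1 - conj x)⁻¹ ∨ z = 1 - (conj x)⁻¹ ∨
        z = conj x / (conj x - 1)) :
    ∃ S : ℤ, FreeAbelianGroup.of z - S • FreeAbelianGroup.of x ∈ AddSubgroup.closure dilogRelators := by
  rcases hz with h | h | h | h | h | h | h | h | h | h | h | h
  · exact anh_fold_six hx h0 h1 (Or.inl h)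
  · exact anh_fold_six hx h0 h1 (Or.inr (Or.inl h))
  · exact anh_fold_six hx h0 h1 (Or.inr (Or.inr (Or.inl h)))
  · exact anh_fold_six hx h0 h1 (Or.inr (Or.inr (Or.inr (Or.inl h))))
  · exact anh_fold_six hx h0 h1 (Or.inr (Or.inr (Or.inr (Or.inr (Or.inl h)))))
  · exact anh_fold_six hx h0 h1 (Or.inr (Or.inr (Or.inr (Or.inr (Or.inr h)))))
  all_goals
    have hx' : IsAlgebraic ℚ (conj x) := by
      simpa using hx.algHom ((starRingEnd ℂ).toRatAlgHom)
    have h0' : conj x ≠ 0 := (map_ne_zero _).2 h0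
    have h1' : conj x ≠ 1 := fun e => h1 (by rw [← Complex.conj_conj x, e, map_one])
    have hc : FreeAbelianGroup.of x + FreeAbelianGroup.of (conj x) ∈ AddSubgroup.closure dilogRelators :=
      AddSubgroup.subset_closure (of_add_of_conj_mem_dilogRelators hx)
  · obtain ⟨S, hS⟩ := anh_fold_six hx' h0' h1' (Or.inl h)
    exact ⟨-S, by convert add_mem hS (AddSubgroup.zsmul_mem _ hc S) using 1; module⟩
  · obtain ⟨S, hS⟩ := anh_fold_six hx' h0' h1' (Or.inr (Or.inl h))
    exact ⟨-S, by convert add_mem hS (AddSubgroup.zsmul_mem _ hc S) using 1; module⟩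
  · obtain ⟨S, hS⟩ := anh_fold_six hx' h0' h1' (Or.inr (Or.inr (Or.inl h)))
    exact ⟨-S, by convert add_mem hS (AddSubgroup.zsmul_mem _ hc S) using 1; module⟩
  · obtain ⟨S, hS⟩ := anh_fold_six hx' h0' h1' (Or.inr (Or.inr (Or.inr (Or.inl h))))
    exact ⟨-S, by convert add_mem hS (AddSubgroup.zsmul_mem _ hc S) using 1; module⟩
  · obtain ⟨S, hS⟩ := anh_fold_six hx' h0' h1' (Or.inr (Or.inr (Or.inr (Or.inr (Or.inl h)))))
    exact ⟨-S, by convert add_mem hS (AddSubgroup.zsmul_mem _ hc S) using 1; module⟩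
  · obtain ⟨S, hS⟩ := anh_fold_six hx' h0' h1' (Or.inr (Or.inr (Or.inr (Or.inr (Or.inr h)))))
    exact ⟨-S, by convert add_mem hS (AddSubgroup.zsmul_mem _ hc S) using 1; module⟩

/-- The twelve images of a REAL `x` are real, hence relators. [folklore] -/
theorem real_fold_twelve {x z : ℂ} (hx : x.im = 0)
    (hz : z = x ∨ z = x⁻¹ ∨ z = 1 - x ∨ z = (1 - x)⁻¹ ∨ z = 1 - x⁻¹ ∨ z = x / (x - 1) ∨
      z = conj x ∨ z = (conj x)⁻¹ ∨ z = 1 - conj x ∨ z = (1 - conj x)⁻¹ ∨ z = 1 - (conj x)⁻¹ ∨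
        z = conj x / (conj x - 1)) :
    FreeAbelianGroup.of z ∈ AddSubgroup.closure dilogRelators := by
  have hcx : conj x = x := Complex.conj_eq_iff_im.2 hx
  rw [hcx] at hz
  have hz6 : z = x ∨ z = x⁻¹ ∨ z = 1 - x ∨ z = (1 - x)⁻¹ ∨ z = 1 - x⁻¹ ∨ z = x / (x - 1) := by tauto
  refine AddSubgroup.subset_closure (of_real_mem_dilogRelators ?_)
  have hinv : ∀ y : ℂ, y.im = 0 → (y⁻¹).im = 0 := fun y hy => by simp [Complex.inv_im, hy]
  have hsub : ∀ y : ℂ, y.im = 0 → (1 - y).im = 0 := fun y hy => by simp [hy]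
  rcases hz6 with rfl | rfl | rfl | rfl | rfl | rfl
  · exact hx
  · exact hinv x hx
  · exact hsub x hx
  · exact hinv _ (hsub x hx)
  · exact hsub _ (hinv x hx)
  · rw [div_eq_mul_inv, Complex.mul_im, hinv _ (by simp [hx]), hx]
    ring

/-- **Stub `stub_gaussExceptionalUnitOrbits` (c5 cycle 4): Zagier's conjecture, Dehn-zero part, EXACTLY and UNCONDITIONALLY on the 147
exceptional units of `ℤ[i,1/10]` — the anharmonic–conjugation orbits of `r₀,…,r₁₄, −1, −4`.** For `z : Fin k → ℂ` valued in these orbits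
(each `zᵢ` one of the twelve images of one of the 17 representatives) and `n : Fin k → ℤ`: if `Σ nᵢ[zᵢ]` has vanishing Dehn invariant and
`Σ nᵢ D(zᵢ) = 0` then `Σ nᵢ[zᵢ] ∈ ⟨dilogRelators⟩`. No Borel, no Suslin, no Dupont. [cite: Neumann1998, §2.1 end (pp. 393–394)] -/
theorem stub_gaussExceptionalUnitOrbits :
    ∀ (k : ℕ) (z : Fin k → ℂ) (n : Fin k → ℤ),
      (∀ i, ∃ w : ℂ, (w = ((-7 : ℂ) + (24 : ℂ) * Complex.I) ∨ w = ((-7 / 25 : ℂ) + (-24 / 25 : ℂ) * Complex.I) ∨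
          w = ((-6 / 5 : ℂ) + (2 / 5 : ℂ) * Complex.I) ∨ w = ((-2 : ℂ) + (4 : ℂ) * Complex.I) ∨ w = ((-1 / 2 : ℂ) * Complex.I) ∨
          w = ((1 / 2 : ℂ) + (-1 : ℂ) * Complex.I) ∨ w = ((-2 : ℂ) + (-1 : ℂ) * Complex.I) ∨ w = ((-1 : ℂ) * Complex.I) ∨
          w = ((1 / 2 : ℂ) + (-3 / 2 : ℂ) * Complex.I) ∨ w = ((-1 : ℂ) + (-1 : ℂ) * Complex.I) ∨ w = ((-1 : ℂ) + (-2 : ℂ) * Complex.I) ∨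
          w = ((1 / 2 : ℂ) + (-7 / 2 : ℂ) * Complex.I) ∨ w = ((-3 : ℂ) + (4 : ℂ) * Complex.I) ∨ w = ((-3 / 5 : ℂ) + (-4 / 5 : ℂ) * Complex.I) ∨
          w = ((1 / 2 : ℂ) + (-11 / 4 : ℂ) * Complex.I) ∨ w = (-1 : ℂ) ∨ w = (-4 : ℂ)) ∧
        (z i = w ∨ z i = w⁻¹ ∨ z i = 1 - w ∨ z i = (1 - w)⁻¹ ∨ z i = 1 - w⁻¹ ∨ z i = w / (w - 1) ∨
          z i = conj w ∨ z i = (conj w)⁻¹ ∨ z i = 1 - conj w ∨ z i = (1 - conj w)⁻¹ ∨ z i = 1 - (conj w)⁻¹ ∨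
            z i = conj w / (conj w - 1))) →
      (∀ u v : Additive ℂˣ →+ ℚ, dehn u v (∑ i, n i • FreeAbelianGroup.of (z i)) = 0) →
      ∑ i, (n i : ℝ) * blochWignerDilog (z i) = 0 →
        (∑ i, n i • FreeAbelianGroup.of (z i)) ∈ AddSubgroup.closure dilogRelators := by
  intro k z n hz hdehn hD
  classical
  set V : Fin 15 → ℂ := (![((-7 : ℂ) + (24 : ℂ) * Complex.I), ((-7 / 25 : ℂ) + (-24 / 25 : ℂ) * Complex.I),
    ((-6 / 5 : ℂ) + (2 / 5 : ℂ) * Complex.I), ((-2 : ℂ) + (4 : ℂ) * Complex.I), ((-1 / 2 : ℂ) * Complex.I),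
    ((1 / 2 : ℂ) + (-1 : ℂ) * Complex.I), ((-2 : ℂ) + (-1 : ℂ) * Complex.I), ((-1 : ℂ) * Complex.I),
    ((1 / 2 : ℂ) + (-3 / 2 : ℂ) * Complex.I), ((-1 : ℂ) + (-1 : ℂ) * Complex.I), ((-1 : ℂ) + (-2 : ℂ) * Complex.I),
    ((1 / 2 : ℂ) + (-7 / 2 : ℂ) * Complex.I), ((-3 : ℂ) + (4 : ℂ) * Complex.I), ((-3 / 5 : ℂ) + (-4 / 5 : ℂ) * Complex.I),
    ((1 / 2 : ℂ) + (-11 / 4 : ℂ) * Complex.I)] : Fin 15 → ℂ) with hV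
  -- fold every point onto ± a representative (or 0 for the real orbits)
  have hfold : ∀ i, ∃ j : Fin 15, ∃ S : ℤ,
      FreeAbelianGroup.of (z i) - S • FreeAbelianGroup.of (V j) ∈ AddSubgroup.closure dilogRelators := by
    intro i
    obtain ⟨w, hw, hzw⟩ := hz i
    have alg : ∀ a b : ℚ, IsAlgebraic ℚ ((a : ℂ) + (b : ℂ) * Complex.I) := fun a b =>
      gaussRat_isAlgebraic' _ a b rfl
    rcases hw with rfl | rfl | rfl | rfl | rfl | rfl | rfl | rfl | rfl | rfl | rfl | rfl | rfl | rfl | rfl | rfl | rfl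
    · obtain ⟨S, hS⟩ := anh_fold_twelve (by simpa using alg (-7) 24) (by norm_num [Complex.ext_iff])
        (by norm_num [Complex.ext_iff]) hzw
      exact ⟨0, S, hS⟩
    · obtain ⟨S, hS⟩ := anh_fold_twelve (by simpa using alg (-7/25) (-24/25)) (by norm_num [Complex.ext_iff])
        (by norm_num [Complex.ext_iff]) hzw
      exact ⟨1, S, hS⟩
    · obtain ⟨S, hS⟩ := anh_fold_twelve (by simpa using alg (-6/5) (2/5)) (by norm_num [Complex.ext_iff])
        (by norm_num [Complex.ext_iff]) hzw
      exact ⟨2, S, hS⟩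
    · obtain ⟨S, hS⟩ := anh_fold_twelve (by simpa using alg (-2) 4) (by norm_num [Complex.ext_iff])
        (by norm_num [Complex.ext_iff]) hzw
      exact ⟨3, S, hS⟩
    · obtain ⟨S, hS⟩ := anh_fold_twelve (by simpa using alg 0 (-1/2)) (by norm_num [Complex.ext_iff])
        (by norm_num [Complex.ext_iff]) hzw
      exact ⟨4, S, hS⟩
    · obtain ⟨S, hS⟩ := anh_fold_twelve (by simpa using alg (1/2) (-1)) (by norm_num [Complex.ext_iff])
        (by norm_num [Complex.ext_iff]) hzw
      exact ⟨5, S, hS⟩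
    · obtain ⟨S, hS⟩ := anh_fold_twelve (by simpa using alg (-2) (-1)) (by norm_num [Complex.ext_iff])
        (by norm_num [Complex.ext_iff]) hzw
      exact ⟨6, S, hS⟩
    · obtain ⟨S, hS⟩ := anh_fold_twelve (by simpa using alg 0 (-1)) (by norm_num [Complex.ext_iff])
        (by norm_num [Complex.ext_iff]) hzw
      exact ⟨7, S, hS⟩
    · obtain ⟨S, hS⟩ := anh_fold_twelve (by simpa using alg (1/2) (-3/2)) (by norm_num [Complex.ext_iff])
        (by norm_num [Complex.ext_iff]) hzw
      exact ⟨8, S, hS⟩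
    · obtain ⟨S, hS⟩ := anh_fold_twelve (by simpa using alg (-1) (-1)) (by norm_num [Complex.ext_iff])
        (by norm_num [Complex.ext_iff]) hzw
      exact ⟨9, S, hS⟩
    · obtain ⟨S, hS⟩ := anh_fold_twelve (by simpa using alg (-1) (-2)) (by norm_num [Complex.ext_iff])
        (by norm_num [Complex.ext_iff]) hzw
      exact ⟨10, S, hS⟩
    · obtain ⟨S, hS⟩ := anh_fold_twelve (by simpa using alg (1/2) (-7/2)) (by norm_num [Complex.ext_iff])
        (by norm_num [Complex.ext_iff]) hzw
      exact ⟨11, S, hS⟩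
    · obtain ⟨S, hS⟩ := anh_fold_twelve (by simpa using alg (-3) 4) (by norm_num [Complex.ext_iff])
        (by norm_num [Complex.ext_iff]) hzw
      exact ⟨12, S, hS⟩
    · obtain ⟨S, hS⟩ := anh_fold_twelve (by simpa using alg (-3/5) (-4/5)) (by norm_num [Complex.ext_iff])
        (by norm_num [Complex.ext_iff]) hzw
      exact ⟨13, S, hS⟩
    · obtain ⟨S, hS⟩ := anh_fold_twelve (by simpa using alg (1/2) (-11/4)) (by norm_num [Complex.ext_iff])
        (by norm_num [Complex.ext_iff]) hzw
      exact ⟨14, S, hS⟩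
    · exact ⟨0, 0, by simpa using real_fold_twelve (by norm_num) hzw⟩
    · exact ⟨0, 0, by simpa using real_fold_twelve (by norm_num) hzw⟩
  choose jf Sf hf using hfold
  -- ξ ≡ ξ' := Σ (nᵢ Sᵢ)[V (j i)]  (mod relators)
  have hdiff : (∑ i, n i • FreeAbelianGroup.of (z i)) - ∑ i, (n i * Sf i) • FreeAbelianGroup.of (V (jf i)) ∈
      AddSubgroup.closure dilogRelators := by
    rw [← Finset.sum_sub_distrib]
    refine sum_mem fun i _ => ?_
    rw [← smul_smul, ← smul_sub]
    exact AddSubgroup.zsmul_mem _ (hf i) _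
  -- regroup fibrewise over Fin 15
  have hre : ∑ i, (n i * Sf i) • FreeAbelianGroup.of (V (jf i)) =
      ∑ j : Fin 15, (∑ i ∈ Finset.univ.filter (fun i => jf i = j), n i * Sf i) • FreeAbelianGroup.of (V j) := by
    rw [← Finset.sum_fiberwise_of_maps_to (s := Finset.univ) (t := Finset.univ) (g := jf) (fun i _ => Finset.mem_univ _)]
    refine Finset.sum_congr rfl fun j _ => ?_
    rw [Finset.sum_smul]
    refine Finset.sum_congr rfl fun i hi => ?_
    rw [(Finset.mem_filter.1 hi).2]
  -- expand the Fin 15 sum into the explicit 15-term form of the row theorem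
  obtain ⟨c0, c1, c2, c3, c4, c5, c6, c7, c8, c9, c10, c11, c12, c13, c14, hcs⟩ :
      ∃ c0 c1 c2 c3 c4 c5 c6 c7 c8 c9 c10 c11 c12 c13 c14 : ℤ,
        (∑ j : Fin 15, (∑ i ∈ Finset.univ.filter (fun i => jf i = j), n i * Sf i) • FreeAbelianGroup.of (V j)) =
          c0 • FreeAbelianGroup.of ((-7 : ℂ) + (24 : ℂ) * Complex.I) + (c1 • FreeAbelianGroup.of ((-7 / 25 : ℂ) + (-24 / 25 : ℂ) * Complex.I) + (c2 • FreeAbelianGroup.of ((-6 / 5 : ℂ) + (2 / 5 : ℂ) * Complex.I) + (c3 • FreeAbelianGroup.of ((-2 : ℂ) + (4 : ℂ) * Complex.I) + (c4 • FreeAbelianGroup.of ((-1 / 2 : ℂ) * Complex.I) + (c5 • FreeAbelianGroup.of ((1 / 2 : ℂ) + (-1 : ℂ) * Complex.I) + (c6 • FreeAbelianGroup.of ((-2 : ℂ) + (-1 : ℂ) * Complex.I) + (c7 • FreeAbelianGroup.of ((-1 : ℂ) * Complex.I) + (c8 • FreeAbelianGroup.of ((1 / 2 : ℂ) + (-3 /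 2 : ℂ) * Complex.I) + (c9 • FreeAbelianGroup.of ((-1 : ℂ) + (-1 : ℂ) * Complex.I) + (c10 • FreeAbelianGroup.of ((-1 : ℂ) + (-2 : ℂ) * Complex.I) + (c11 • FreeAbelianGroup.of ((1 / 2 : ℂ) + (-7 / 2 : ℂ) * Complex.I) + (c12 • FreeAbelianGroup.of ((-3 : ℂ) + (4 : ℂ) * Complex.I) + (c13 • FreeAbelianGroup.of ((-3 / 5 : ℂ) + (-4 / 5 : ℂ) * Complex.I) + c14 • FreeAbelianGroup.of ((1 / 2 : ℂ) + (-11 / 4 : ℂ) * Complex.I)))))))))))))) :=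
    ⟨_, _, _, _, _, _, _, _, _, _, _, _, _, _, _, by
      simp only [Fin.sum_univ_succ, Fin.sum_univ_zero, hV, Matrix.cons_val_zero, Matrix.cons_val_succ, add_zero]
      rfl⟩
  have hleft : (∑ i, (n i * Sf i) • FreeAbelianGroup.of (V (jf i))) =
      c0 • FreeAbelianGroup.of ((-7 : ℂ) + (24 : ℂ) * Complex.I) + c1 • FreeAbelianGroup.of ((-7 / 25 : ℂ) + (-24 / 25 : ℂ) * Complex.I) + c2 • FreeAbelianGroup.of ((-6 / 5 : ℂ) + (2 / 5 : ℂ) * Complex.I) + c3 • FreeAbelianGroup.of ((-2 : ℂ) + (4 : ℂ) * Complex.I) + c4 • FreeAbelianGroup.of ((-1 / 2 : ℂ) * Complex.I) + c5 • FreeAbelianGroup.of ((1 / 2 : ℂ) + (-1 : ℂ) * Complex.I) + c6 • FreeAbelianGroup.of ((-2 : ℂ) + (-1 : ℂ) * Complex.I) + c7 • FreeAbelianGroup.of ((-1 : ℂ) * Complex.I) + c8 • FreeAbelianGroup.of ((1 / 2 : ℂ) + (-3 / 2 : ℂ) * Complex.I) + c9 • FreeAbelianGroup.of ((-1 : ℂ)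 + (-1 : ℂ) * Complex.I) + c10 • FreeAbelianGroup.of ((-1 : ℂ) + (-2 : ℂ) * Complex.I) + c11 • FreeAbelianGroup.of ((1 / 2 : ℂ) + (-7 / 2 : ℂ) * Complex.I) + c12 • FreeAbelianGroup.of ((-3 : ℂ) + (4 : ℂ) * Complex.I) + c13 • FreeAbelianGroup.of ((-3 / 5 : ℂ) + (-4 / 5 : ℂ) * Complex.I) + c14 • FreeAbelianGroup.of ((1 / 2 : ℂ) + (-11 / 4 : ℂ) * Complex.I) := by
    rw [hre, hcs]
    abel
  have hmem : (∑ i, n i • FreeAbelianGroup.of (z i)) - (c0 • FreeAbelianGroup.of ((-7 : ℂ) + (24 : ℂ) * Complex.I) + c1 • FreeAbelianGroup.of ((-7 / 25 : ℂ) + (-24 / 25 : ℂ) * Complex.I) + c2 • FreeAbelianGroup.of ((-6 / 5 : ℂ) + (2 / 5 : ℂ) * Complex.I) + c3 • FreeAbelianGroup.of ((-2 : ℂ) + (4 : ℂ) * Complex.I) + c4 • FreeAbelianGroup.of ((-1 / 2 : ℂ) * Complex.I) + c5 • FreeAbelianGroup.of ((1 / 2 : ℂ) + (-1 : ℂ)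 * Complex.I) + c6 • FreeAbelianGroup.of ((-2 : ℂ) + (-1 : ℂ) * Complex.I) + c7 • FreeAbelianGroup.of ((-1 : ℂ) * Complex.I) + c8 • FreeAbelianGroup.of ((1 / 2 : ℂ) + (-3 / 2 : ℂ) * Complex.I) + c9 • FreeAbelianGroup.of ((-1 : ℂ) + (-1 : ℂ) * Complex.I) + c10 • FreeAbelianGroup.of ((-1 : ℂ) + (-2 : ℂ) * Complex.I) + c11 • FreeAbelianGroup.of ((1 / 2 : ℂ) + (-7 / 2 : ℂ) * Complex.I) + c12 • FreeAbelianGroup.of ((-3 : ℂ) + (4 : ℂ) * Complex.I) + c13 • FreeAbelianGroup.of ((-3 / 5 : ℂ) + (-4 / 5 : ℂ) * Complex.I) + c14 • FreeAbelianGroup.of ((1 / 2 : ℂ) + (-11 / 4 : ℂ) * Complex.I)) ∈ AddSubgroup.closure dilogRelators := by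
    rw [← hleft]
    exact hdiff
  have hdehn' : ∀ u v : Additive ℂˣ →+ ℚ,
      dehn u v (c0 • FreeAbelianGroup.of ((-7 : ℂ) + (24 : ℂ) * Complex.I) +
          c1 • FreeAbelianGroup.of ((-7 / 25 : ℂ) + (-24 / 25 : ℂ) * Complex.I) +
          c2 • FreeAbelianGroup.of ((-6 / 5 : ℂ) + (2 / 5 : ℂ) * Complex.I) +
          c3 • FreeAbelianGroup.of ((-2 : ℂ) + (4 : ℂ) * Complex.I) +
          c4 • FreeAbelianGroup.of ((-1 / 2 : ℂ) * Complex.I) +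
          c5 • FreeAbelianGroup.of ((1 / 2 : ℂ) + (-1 : ℂ) * Complex.I) +
          c6 • FreeAbelianGroup.of ((-2 : ℂ) + (-1 : ℂ) * Complex.I) +
          c7 • FreeAbelianGroup.of ((-1 : ℂ) * Complex.I) +
          c8 • FreeAbelianGroup.of ((1 / 2 : ℂ) + (-3 / 2 : ℂ) * Complex.I) +
          c9 • FreeAbelianGroup.of ((-1 : ℂ) + (-1 : ℂ) * Complex.I) +
          c10 • FreeAbelianGroup.of ((-1 : ℂ) + (-2 : ℂ) * Complex.I) +
          c11 • FreeAbelianGroup.of ((1 / 2 : ℂ) + (-7 / 2 : ℂ) * Complex.I) +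
          c12 • FreeAbelianGroup.of ((-3 : ℂ) + (4 : ℂ) * Complex.I) +
          c13 • FreeAbelianGroup.of ((-3 / 5 : ℂ) + (-4 / 5 : ℂ) * Complex.I) +
          c14 • FreeAbelianGroup.of ((1 / 2 : ℂ) + (-11 / 4 : ℂ) * Complex.I)) = 0 := by
    intro u v
    have h1 := dehn_eq_zero_of_mem_closure u v hmem
    rw [map_sub, hdehn u v, zero_sub, neg_eq_zero] at h1
    exact h1
  have hD' : (c0 : ℝ) * blochWignerDilog ((-7 : ℂ) + (24 : ℂ) * Complex.I) + (c1 : ℝ) * blochWignerDilog ((-7 / 25 : ℂ) + (-24 / 25 : ℂ) * Complex.I) + (c2 : ℝ) * blochWignerDilog ((-6 / 5 : ℂ) + (2 / 5 : ℂ) * Complex.I) + (c3 : ℝ) * blochWignerDilog ((-2 : ℂ) + (4 : ℂ) * Complex.I) + (c4 : ℝ) * blochWignerDilog ((-1 / 2 : ℂ) * Complex.I) + (c5 : ℝ) * blochWignerDilog ((1 / 2 : ℂ) + (-1 : ℂ) * Complex.I) + (c6 : ℝ) * blochWignerDilog ((-2 : ℂ) + (-1 : ℂ) * Complex.I) + (c7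 : ℝ) * blochWignerDilog ((-1 : ℂ) * Complex.I) + (c8 : ℝ) * blochWignerDilog ((1 / 2 : ℂ) + (-3 / 2 : ℂ) * Complex.I) + (c9 : ℝ) * blochWignerDilog ((-1 : ℂ) + (-1 : ℂ) * Complex.I) + (c10 : ℝ) * blochWignerDilog ((-1 : ℂ) + (-2 : ℂ) * Complex.I) + (c11 : ℝ) * blochWignerDilog ((1 / 2 : ℂ) + (-7 / 2 : ℂ) * Complex.I) + (c12 : ℝ) * blochWignerDilog ((-3 : ℂ) + (4 : ℂ) * Complex.I) + (c13 : ℝ) * blochWignerDilog ((-3 / 5 : ℂ) + (-4 / 5 : ℂ) * Complex.I) + (c14 : ℝ) * blochWignerDilog ((1 / 2 : ℂ) + (-11 / 4 : ℂ) * Complex.I) = 0 := by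
    have h1 := ZagierDilogarithm.lift_eq_zero_of_mem_closure hmem
    rw [map_sub, ZagierDilogarithm.lift_sum_zsmul_of, hD, zero_sub, neg_eq_zero] at h1
    simp only [map_add, map_zsmul, FreeAbelianGroup.lift_apply_of] at h1
    simp only [zsmul_eq_mul] at h1
    linear_combination h1
  have key := stub_gaussUnitSector c0 c1 c2 c3 c4 c5 c6 c7 c8 c9 c10 c11 c12 c13 c14 hdehn' hD'
  have := add_mem hmem key
  rwa [sub_add_cancel] at this

end Summit.KontsevichZagierPeriods.HyperbolicBloch.ZagierDilogarithmCertificate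

end
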